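import Summits.HubbardSuperconductivity.HubbardSuperconductivity.Theorems.KLProgrammeKLRegimeFlowReadScaleZeroSunsetCertRowsRecordsFarSup

/-!
# Route `KLProgramme`, crux K3 — engine-flow child (stmt-HubbardSuperconductivity-20437), stub (C) at `n = 0`, located item #22a «(C)-SCALE0-PT2»:
# THE WINDOW COVER — per-cell record BUNDLES, their decidable side conditions, and the one-call at EVERY `μ ∈ klWindowC` from a finite chain of cells

Seat hubbard-kl-k3c5-p1 (g18; owner of #22a).  The chain of record ((R346)/(R361)/(R414)): near records in format (α) (one `SunsetCellRecordV3` per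
μ-grid point / μ-cell covering `klWindowC`, split radius `Rc = 1024`), ONE far-gap record `SunsetFarGapRecord` per cell (KIT JOB B′) and ONE μ-free far-sup
record `SunsetFarSupRecord` (B″, booked `Sfar = 353521920428/10¹⁶`), consumed per cell by `…SunsetCertRowsRecordsFarSup.sunsetRows_of_records_farSup`
(p1 g22 / k3c5 g15), whose side conditions are closed rational inequalities.  What the consumer of the (C) row at `n = 0` needs is the pair of certified
sunset rows `hS0`/`hSk` of `…FlowReadScaleZeroAssembly.twoLegRead_frameZero_of_sunsetData` at EVERY `μ ∈ klWindowC` (tables chosen after `μ`).  This file is the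
missing Lean glue between the two («cover lemma», CONSUMER-MAP §kit), written once and for all so that the instantiation file of a production run is
LITERALS + `decide`/`norm_num` only:
* §1 `SunsetCellBundle` — one cell's data as Lean reads it: near record `c`, far-gap record `r`, the emitted square-root majorants `s₀ ≥ √G₀`, `s₂ ≥ √G₂`
  and the three budget values `bS k`; `SunsetCellBundle.budget` — the rational left-hand side of the budget row of `sunsetRows_of_records_farSup`;
  `SunsetCellBundle.SideOK b rs` — ALL rational side conditions of that one-call as ONE proposition (a conjunction of `ℕ`/`ℚ`
  inequalities: `simp only [SunsetCellBundle.SideOK, …]; norm_num` or `decide` closes it on literals); `SunsetCellBundle.bSℝ` — the budget row as the consumer's `ℕ → ℝ` table;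
* §2 `exists_mem_cell_of_chain` — the COVER LEMMA: a nonempty list of rational cells `(lo, hi)` whose first `lo ≤ a`, last `hi ≥ b` and consecutive
  cells touch or overlap (`List.IsChain (fun c d => d.1 ≤ c.2)`, decidable) contains, for every real `μ ∈ [a, b]`, a cell with `lo ≤ μ ≤ hi`;
* §3 `sunsetRows_of_bundle` — `sunsetRows_of_records_farSup` for a bundle whose `SideOK` holds (the `ℚ → ℝ` casts done here, once);
  **`sunsetRows_window_of_bundles`** — at every `μ ∈ klWindowC`: from a list of bundles covering the window, each with its three certificates and `SideOK`,
  SOME bundle of the list contains `μ` and delivers `hS0`/`hSk` with `bS := b.bSℝ`; **`sunsetRows_window_of_chain`** — the same with the cover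
  hypothesis in the decidable chain form of §2 on `l.map (fun b => (b.c.μlo, b.c.μhi))` with `a = -21/20`, `b = -3/20` (`klWindowC = [-1.05, -0.15]`).

Definitions + glue proofs only; the certificates stay HYPOTHESES (kit records: W4 near records UNRUN, B′ UNRUN, B″ booked); nothing here asserts (C), any stub of
20437, K3, the margin or superconductivity.  References: BGM 2006 §2.3–§2.4 [cite: BenfattoGiulianiMastropietro2006].
-/

noncomputable section

namespace Summit.HubbardSuperconductivity.HubbardSuperconductivity.Theorems.KLRegimeSplit

set_option linter.dupNamespace false -- summit = problem name (single-conjunct summit), D-0017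

open Literature.MathematicalPhysics.QuantumLattice Literature.Probability.LatticeModels Literature.Analysis.FunctionSpaces
open Summit.HubbardSuperconductivity.HubbardSuperconductivity.Theorems.DispersionFlow
open Summit.HubbardSuperconductivity.HubbardSuperconductivity.Theorems.EngineV8
open MeasureTheory Finset Complex UnitAddTorus Real

/-! ## §1 Bundles and their decidable side conditions -/

/-- **One cell's data as Lean reads it**: the near record `c` (μ-cell, split radius, three row totals, tail allowance), the far-gap record `r`
(crossover `ω₁`, gaps `G₀`, `G₂`), square-root majorants `s₀, s₂` (`G₀ ≤ s₀²`, `G₂ ≤ s₂²`, emitted by the kit as rationals) and the three budget values `bS`.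
[cite: BenfattoGiulianiMastropietro2006, §2.3-§2.4] -/
structure SunsetCellBundle where
  /-- near record (KIT JOB A / W4) -/
  c : SunsetCellRecordV3
  /-- far-gap record (KIT JOB B′) -/
  r : SunsetFarGapRecord
  /-- rational square-root majorant of `r.G₀` -/
  s₀ : ℚ
  /-- rational square-root majorant of `r.G₂` -/
  s₂ : ℚ
  /-- the budget row `bS 0, bS 1, bS 2` fed to `twoLegRead_frameZero_of_sunsetData` -/
  bS : Fin 3 → ℚ

namespace SunsetCellBundle

/-- The square-root majorant vector `t = (s₀, (s₀+s₂)/2, s₂)` of the three rows (row 1 by Cauchy–Schwarz). [cite: BenfattoGiulianiMastropietro2006, §2.3-§2.4] -/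
def tVec (b : SunsetCellBundle) (k : Fin 3) : ℚ := ![b.s₀, (b.s₀ + b.s₂) / 2, b.s₂] k

/-- **The rational left-hand side of the budget row** of `sunsetRows_of_records_farSup` for the far-sup record `rs`:
`row k + (Sfar + 10⁻²⁹)·(2·10⁻⁸ + ω₁·(t_k + 10⁻¹⁰)²)`. [cite: BenfattoGiulianiMastropietro2006, §2.3-§2.4] -/
def budget (b : SunsetCellBundle) (rs : SunsetFarSupRecord) (k : Fin 3) : ℚ :=
  b.c.row k + (rs.Sfar + 10⁻¹ ^ 29) * (2 * 10⁻¹ ^ 8 + b.r.ω₁ * (b.tVec k + 10⁻¹ ^ 10) ^ 2)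

/-- **ALL rational side conditions of the per-cell one-call, as one decidable proposition** (closed by `decide` / `norm_num` on literals):
the near record's `4Rc+2 ≤ 2¹⁰·129²·(2²⁰+1)²`, `10⁻³⁰ ≤ Tmax`, `0 ≤ row k`; the far-gap record's `1/32 ≤ ω₁ ≤ 1/4`, `255 ≤ ω₁(Rc+1)`, `0 ≤ G₂`,
`G₀ ≤ s₀²`, `G₂ ≤ s₂²`, `0 ≤ s₀, s₂`; the far-sup record's `0 ≤ Sfar`; and the three budget rows `budget k ≤ bS k`.
[cite: BenfattoGiulianiMastropietro2006, §2.3-§2.4] -/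
def SideOK (b : SunsetCellBundle) (rs : SunsetFarSupRecord) : Prop :=
  4 * b.c.Rc + 2 ≤ 2 ^ 10 * 129 ^ 2 * (2 ^ 20 + 1) ^ 2 ∧
  (10 : ℚ)⁻¹ ^ 30 ≤ b.c.Tmax ∧ (0 ≤ b.c.row 0 ∧ 0 ≤ b.c.row 1 ∧ 0 ≤ b.c.row 2) ∧
  ((1 : ℚ) / 32 ≤ b.r.ω₁ ∧ b.r.ω₁ ≤ 1 / 4 ∧ 255 ≤ b.r.ω₁ * ((b.c.Rc : ℚ) + 1) ∧ 0 ≤ b.r.G₂) ∧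
  (b.r.G₀ ≤ b.s₀ ^ 2 ∧ b.r.G₂ ≤ b.s₂ ^ 2 ∧ 0 ≤ b.s₀ ∧ 0 ≤ b.s₂) ∧
  0 ≤ rs.Sfar ∧
  (b.budget rs 0 ≤ b.bS 0 ∧ b.budget rs 1 ≤ b.bS 1 ∧ b.budget rs 2 ≤ b.bS 2)

/-- The budget row as the consumer's `ℕ → ℝ` table: `bS k` for `k < 3`, `0` beyond. [cite: BenfattoGiulianiMastropietro2006, §2.3-§2.4] -/
def bSℝ (b : SunsetCellBundle) : ℕ → ℝ := fun k => if h : k < 3 then ((b.bS ⟨k, h⟩ : ℚ) : ℝ) else 0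

/-- On `Fin 3` the real table is the cast of the rational one. [cite: BenfattoGiulianiMastropietro2006, §2.3-§2.4] -/
theorem bSℝ_fin (b : SunsetCellBundle) (k : Fin 3) : b.bSℝ k = ((b.bS k : ℚ) : ℝ) := by
  simp [bSℝ, k.isLt]

/-- The cast of the square-root majorant vector. [cite: BenfattoGiulianiMastropietro2006, §2.3-§2.4] -/
theorem tVec_cast (b : SunsetCellBundle) (k : Fin 3) :
    ((b.tVec k : ℚ) : ℝ) = ![(b.s₀ : ℝ), ((b.s₀ : ℝ) + b.s₂) / 2, (b.s₂ : ℝ)] k := by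
  fin_cases k <;> simp [tVec]

/-- The cast of the budget row: the real left-hand side of `sunsetRows_of_records_farSup`'s `hbS`. [cite: BenfattoGiulianiMastropietro2006, §2.3-§2.4] -/
theorem budget_cast (b : SunsetCellBundle) (rs : SunsetFarSupRecord) (k : Fin 3) :
    ((b.budget rs k : ℚ) : ℝ) = (b.c.row k : ℝ) +
      ((rs.Sfar : ℝ) + (10 : ℝ)⁻¹ ^ 29) *
        (2 * (10 : ℝ)⁻¹ ^ 8 + (b.r.ω₁ : ℝ) * (![(b.s₀ : ℝ), ((b.s₀ : ℝ) + b.s₂) / 2, (b.s₂ : ℝ)] k + (10 : ℝ)⁻¹ ^ 10) ^ 2) := by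
  rw [← tVec_cast]
  simp only [budget]
  push_cast
  ring

end SunsetCellBundle

/-! ## §2 The cover lemma -/

/-- **COVER LEMMA** (decidable hypotheses): a nonempty chain of rational cells — first left end `≤ a`, last right end `≥ b`, each next left end `≤` the
previous right end — contains, for every real `μ ∈ [a, b]`, a cell `(lo, hi)` with `lo ≤ μ ≤ hi`. [cite: BenfattoGiulianiMastropietro2006, §2.3-§2.4] -/
theorem exists_mem_cell_of_chain :
    ∀ (l : List (ℚ × ℚ)) (a b : ℚ), l ≠ [] → (∀ c ∈ l.head?, c.1 ≤ a) → (∀ c ∈ l.getLast?, b ≤ c.2) →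
      l.IsChain (fun c d => d.1 ≤ c.2) → ∀ μ : ℝ, (a : ℝ) ≤ μ → μ ≤ (b : ℝ) → ∃ c ∈ l, (c.1 : ℝ) ≤ μ ∧ μ ≤ (c.2 : ℝ)
  | [], _, _, h, _, _, _, _, _, _ => absurd rfl h
  | [c], a, b, _, ha, hb, _, μ, hμa, hμb => by
      refine ⟨c, List.mem_singleton_self _, ?_, ?_⟩
      · have h1 : c.1 ≤ a := ha c (by simp)
        exact le_trans (by exact_mod_cast h1) hμa
      · have h2 : b ≤ c.2 := hb c (by simp)
        exact le_trans hμb (by exact_mod_cast h2)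
  | c :: d :: t, a, b, _, ha, hb, hch, μ, hμa, hμb => by
      by_cases hμc : μ ≤ (c.2 : ℝ)
      · have h1 : c.1 ≤ a := ha c (by simp)
        exact ⟨c, List.mem_cons_self, le_trans (by exact_mod_cast h1) hμa, hμc⟩
      · have hdc : d.1 ≤ c.2 := (List.isChain_cons_cons.1 hch).1
        have htail : (d :: t).IsChain (fun c d => d.1 ≤ c.2) := (List.isChain_cons_cons.1 hch).2
        have ha' : ∀ e ∈ (d :: t).head?, e.1 ≤ c.2 := by
          intro e he
          simp only [List.head?_cons, Option.mem_def, Option.some.injEq] at he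
          subst he
          exact hdc
        have hb' : ∀ e ∈ (d :: t).getLast?, b ≤ e.2 := by
          intro e he
          exact hb e (by rw [List.getLast?_cons_cons]; exact he)
        obtain ⟨e, he, h1, h2⟩ :=
          exists_mem_cell_of_chain (d :: t) c.2 b (List.cons_ne_nil _ _) ha' hb' htail μ (le_of_lt (not_le.1 hμc)) hμb
        exact ⟨e, List.mem_cons_of_mem _ he, h1, h2⟩

/-! ## §3 The one-call per bundle and at every `μ` of the window -/

section Window

variable {L M : ℕ} [NeZero L]

/-- **The per-cell one-call for a bundle** whose decidable side conditions hold: `sunsetRows_of_records_farSup` with the `ℚ → ℝ` casts done here.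
[cite: BenfattoGiulianiMastropietro2006, §2.3-§2.4] -/
theorem sunsetRows_of_bundle [NeZero M] (b : SunsetCellBundle) (rs : SunsetFarSupRecord)
    (hc : ScaleZeroSunsetCertV3 b.c) (hr : ScaleZeroFarGapCert b.c.toSunsetCellRecordV2 b.r)
    (hrs : ScaleZeroFarSupCert b.c.toSunsetCellRecordV2 rs) (hside : b.SideOK rs)
    {μ β U : ℝ} (hμ : μ ∈ klWindowC) (hμlo : (b.c.μlo : ℝ) ≤ μ) (hμhi : μ ≤ b.c.μhi)
    (hβ : klBetaMin ≤ β) (hU0 : 0 < U) (hU : U ≤ (2 : ℝ)⁻¹ ^ 20) (hL3 : klEngL₃ β U ≤ L) (hM3 : klEngM₃ β U L ≤ M) :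
    (∀ (σ : Fin 2) (p₀ : GridPoint L (2 * (2 * M))), ∑ p₁ : GridPoint L (2 * (2 * M)),
      (if p₁ = p₀ then (0 : ℝ) else (if p₁.2 - p₀.2 = 0 then (0 : ℝ) else 1) * ‖contr ℂ ((hubbardGridSub L M β (2 * (2 * M))).transpose * hubbardCovAboveCT L M β μ 0 0 klE0 *
                hubbardGridSub L M β (2 * (2 * M))) (((p₁, σ), 0) : GridLeg (GridPoint L (2 * (2 * M)))) ((p₀, σ), 1) *
              (contr ℂ ((hubbardGridSub L M β (2 * (2 * M))).transpose * hubbardCovAboveCT L M β μ 0 0 klE0 *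
                hubbardGridSub L M β (2 * (2 * M))) (((p₀, σ.rev), 0) : GridLeg (GridPoint L (2 * (2 * M)))) ((p₁, σ.rev), 1) *
                contr ℂ ((hubbardGridSub L M β (2 * (2 * M))).transpose * hubbardCovAboveCT L M β μ 0 0 klE0 *
                hubbardGridSub L M β (2 * (2 * M))) (((p₁, σ.rev), 0) : GridLeg (GridPoint L (2 * (2 * M)))) ((p₀, σ.rev), 1))‖) ≤ b.bSℝ 0 * (((2 * (2 * M) : ℕ) : ℝ) / β)) ∧
    (∀ k, 1 ≤ k → k ≤ 2 → ∀ (σ : Fin 2) (p₀ : GridPoint L (2 * (2 * M))), ∑ p₁ : GridPoint L (2 * (2 * M)),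
      (if p₁ = p₀ then (0 : ℝ) else
        Real.sqrt ((((p₁.2 - p₀.2) 0).valMinAbs.natAbs : ℝ) ^ 2 + (((p₁.2 - p₀.2) 1).valMinAbs.natAbs : ℝ) ^ 2) ^ k * ‖contr ℂ ((hubbardGridSub L M β (2 * (2 * M))).transpose * hubbardCovAboveCT L M β μ 0 0 klE0 *
                hubbardGridSub L M β (2 * (2 * M))) (((p₁, σ), 0) : GridLeg (GridPoint L (2 * (2 * M)))) ((p₀, σ), 1) *
              (contr ℂ ((hubbardGridSub L M β (2 * (2 * M))).transpose * hubbardCovAboveCT L M β μ 0 0 klE0 *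
                hubbardGridSub L M β (2 * (2 * M))) (((p₀, σ.rev), 0) : GridLeg (GridPoint L (2 * (2 * M)))) ((p₁, σ.rev), 1) *
                contr ℂ ((hubbardGridSub L M β (2 * (2 * M))).transpose * hubbardCovAboveCT L M β μ 0 0 klE0 *
                hubbardGridSub L M β (2 * (2 * M))) (((p₁, σ.rev), 0) : GridLeg (GridPoint L (2 * (2 * M)))) ((p₀, σ.rev), 1))‖) ≤
        b.bSℝ k * (((2 * (2 * M) : ℕ) : ℝ) / β)) := by
  obtain ⟨hRc', hTmax, ⟨hrow0, hrow1, hrow2⟩, ⟨hω₁, hω₁', hωRc, hG₂⟩, ⟨hs₀, hs₂, hs₀0, hs₂0⟩, hSfar, ⟨hb0, hb1, hb2⟩⟩ := hside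
  have hrow : ∀ k : Fin 3, 0 ≤ b.c.row k := by
    intro k; fin_cases k
    · exact hrow0
    · exact hrow1
    · exact hrow2
  have hbSq : ∀ k : Fin 3, b.budget rs k ≤ b.bS k := by
    intro k; fin_cases k
    · exact hb0
    · exact hb1
    · exact hb2
  have hbS : ∀ k : Fin 3, (b.c.row k : ℝ) +
      ((rs.Sfar : ℝ) + (10 : ℝ)⁻¹ ^ 29) *
        (2 * (10 : ℝ)⁻¹ ^ 8 + (b.r.ω₁ : ℝ) * (![(b.s₀ : ℝ), ((b.s₀ : ℝ) + b.s₂) / 2, (b.s₂ : ℝ)] k + (10 : ℝ)⁻¹ ^ 10) ^ 2) ≤ b.bSℝ k := by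
    intro k
    rw [← SunsetCellBundle.budget_cast, SunsetCellBundle.bSℝ_fin]
    exact_mod_cast hbSq k
  have h := sunsetRows_of_records_farSup (L := L) (M := M) b.c hc b.r hr rs hrs hμ hμlo hμhi hβ hU0 hU hL3 hM3
    hRc' hTmax hrow hω₁ hω₁' hωRc hG₂ hs₀ hs₂ hs₀0 hs₂0 hSfar (bS := b.bSℝ) hbS
  refine ⟨h.1, fun k hk1 hk2 => ?_⟩
  exact h.2 k hk1 hk2

/-- **THE CERTIFIED SUNSET ROWS AT EVERY `μ` OF THE WINDOW, from a finite list of bundles covering it**: if every bundle of `l` carries its near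
certificate, its far-gap certificate, the far-sup certificate of the μ-free record `rs` on its far sites and its decidable `SideOK`, and the cells of `l`
cover `klWindowC`, then at every `μ ∈ klWindowC` some bundle `b ∈ l` contains `μ` and delivers `hS0`/`hSk` with the table `b.bSℝ` (regime hypotheses the engine's).
[cite: BenfattoGiulianiMastropietro2006, §2.3-§2.4] -/
theorem sunsetRows_window_of_bundles [NeZero M] (l : List SunsetCellBundle) (rs : SunsetFarSupRecord)
    (hcov : ∀ μ ∈ klWindowC, ∃ b ∈ l, (b.c.μlo : ℝ) ≤ μ ∧ μ ≤ b.c.μhi)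
    (hc : ∀ b ∈ l, ScaleZeroSunsetCertV3 b.c) (hr : ∀ b ∈ l, ScaleZeroFarGapCert b.c.toSunsetCellRecordV2 b.r)
    (hrs : ∀ b ∈ l, ScaleZeroFarSupCert b.c.toSunsetCellRecordV2 rs) (hside : ∀ b ∈ l, b.SideOK rs)
    {μ β U : ℝ} (hμ : μ ∈ klWindowC)
    (hβ : klBetaMin ≤ β) (hU0 : 0 < U) (hU : U ≤ (2 : ℝ)⁻¹ ^ 20) (hL3 : klEngL₃ β U ≤ L) (hM3 : klEngM₃ β U L ≤ M) :
    ∃ b ∈ l, ((b.c.μlo : ℝ) ≤ μ ∧ μ ≤ b.c.μhi) ∧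
    (∀ (σ : Fin 2) (p₀ : GridPoint L (2 * (2 * M))), ∑ p₁ : GridPoint L (2 * (2 * M)),
      (if p₁ = p₀ then (0 : ℝ) else (if p₁.2 - p₀.2 = 0 then (0 : ℝ) else 1) * ‖contr ℂ ((hubbardGridSub L M β (2 * (2 * M))).transpose * hubbardCovAboveCT L M β μ 0 0 klE0 *
                hubbardGridSub L M β (2 * (2 * M))) (((p₁, σ), 0) : GridLeg (GridPoint L (2 * (2 * M)))) ((p₀, σ), 1) *
              (contr ℂ ((hubbardGridSub L M β (2 * (2 * M))).transpose * hubbardCovAboveCT L M β μ 0 0 klE0 *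
                hubbardGridSub L M β (2 * (2 * M))) (((p₀, σ.rev), 0) : GridLeg (GridPoint L (2 * (2 * M)))) ((p₁, σ.rev), 1) *
                contr ℂ ((hubbardGridSub L M β (2 * (2 * M))).transpose * hubbardCovAboveCT L M β μ 0 0 klE0 *
                hubbardGridSub L M β (2 * (2 * M))) (((p₁, σ.rev), 0) : GridLeg (GridPoint L (2 * (2 * M)))) ((p₀, σ.rev), 1))‖) ≤ b.bSℝ 0 * (((2 * (2 * M) : ℕ) : ℝ) / β)) ∧
    (∀ k, 1 ≤ k → k ≤ 2 → ∀ (σ : Fin 2) (p₀ : GridPoint L (2 * (2 * M))), ∑ p₁ : GridPoint L (2 * (2 * M)),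
      (if p₁ = p₀ then (0 : ℝ) else
        Real.sqrt ((((p₁.2 - p₀.2) 0).valMinAbs.natAbs : ℝ) ^ 2 + (((p₁.2 - p₀.2) 1).valMinAbs.natAbs : ℝ) ^ 2) ^ k * ‖contr ℂ ((hubbardGridSub L M β (2 * (2 * M))).transpose * hubbardCovAboveCT L M β μ 0 0 klE0 *
                hubbardGridSub L M β (2 * (2 * M))) (((p₁, σ), 0) : GridLeg (GridPoint L (2 * (2 * M)))) ((p₀, σ), 1) *
              (contr ℂ ((hubbardGridSub L M β (2 * (2 * M))).transpose * hubbardCovAboveCT L M β μ 0 0 klE0 *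
                hubbardGridSub L M β (2 * (2 * M))) (((p₀, σ.rev), 0) : GridLeg (GridPoint L (2 * (2 * M)))) ((p₁, σ.rev), 1) *
                contr ℂ ((hubbardGridSub L M β (2 * (2 * M))).transpose * hubbardCovAboveCT L M β μ 0 0 klE0 *
                hubbardGridSub L M β (2 * (2 * M))) (((p₁, σ.rev), 0) : GridLeg (GridPoint L (2 * (2 * M)))) ((p₀, σ.rev), 1))‖) ≤
        b.bSℝ k * (((2 * (2 * M) : ℕ) : ℝ) / β)) := by
  obtain ⟨b, hb, hμlo, hμhi⟩ := hcov μ hμ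
  exact ⟨b, hb, ⟨hμlo, hμhi⟩, sunsetRows_of_bundle (L := L) (M := M) b rs (hc b hb) (hr b hb) (hrs b hb) (hside b hb) hμ hμlo hμhi hβ hU0 hU hL3 hM3⟩

/-- `klWindowC = [-21/20, -3/20]` with rational ends. [cite: BenfattoGiulianiMastropietro2006, §2.3-§2.4] -/
theorem mem_klWindowC_iff_rat (μ : ℝ) : μ ∈ klWindowC ↔ (((-21) / 20 : ℚ) : ℝ) ≤ μ ∧ μ ≤ (((-3) / 20 : ℚ) : ℝ) := by
  simp only [klWindowC, Set.mem_Icc]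
  constructor
  · rintro ⟨h1, h2⟩; constructor <;> push_cast <;> linarith
  · rintro ⟨h1, h2⟩; push_cast at h1 h2; constructor <;> linarith

/-- **THE CERTIFIED SUNSET ROWS AT EVERY `μ` OF THE WINDOW — decidable cover form**: as `sunsetRows_window_of_bundles`, the cover hypothesis being the
chain conditions of `exists_mem_cell_of_chain` on the cell list `l.map (fun b => (b.c.μlo, b.c.μhi))` with ends `-21/20`, `-3/20` (each `decide` on literals).
[cite: BenfattoGiulianiMastropietro2006, §2.3-§2.4] -/
theorem sunsetRows_window_of_chain [NeZero M] (l : List SunsetCellBundle) (rs : SunsetFarSupRecord)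
    (hne : l.map (fun b => (b.c.μlo, b.c.μhi)) ≠ [])
    (hhead : ∀ c ∈ (l.map (fun b => (b.c.μlo, b.c.μhi))).head?, c.1 ≤ (-21) / 20)
    (hlast : ∀ c ∈ (l.map (fun b => (b.c.μlo, b.c.μhi))).getLast?, (-3) / 20 ≤ c.2)
    (hchain : (l.map (fun b => (b.c.μlo, b.c.μhi))).IsChain (fun c d => d.1 ≤ c.2))
    (hc : ∀ b ∈ l, ScaleZeroSunsetCertV3 b.c) (hr : ∀ b ∈ l, ScaleZeroFarGapCert b.c.toSunsetCellRecordV2 b.r)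
    (hrs : ∀ b ∈ l, ScaleZeroFarSupCert b.c.toSunsetCellRecordV2 rs) (hside : ∀ b ∈ l, b.SideOK rs)
    {μ β U : ℝ} (hμ : μ ∈ klWindowC)
    (hβ : klBetaMin ≤ β) (hU0 : 0 < U) (hU : U ≤ (2 : ℝ)⁻¹ ^ 20) (hL3 : klEngL₃ β U ≤ L) (hM3 : klEngM₃ β U L ≤ M) :
    ∃ b ∈ l, ((b.c.μlo : ℝ) ≤ μ ∧ μ ≤ b.c.μhi) ∧
    (∀ (σ : Fin 2) (p₀ : GridPoint L (2 * (2 * M))), ∑ p₁ : GridPoint L (2 * (2 * M)),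
      (if p₁ = p₀ then (0 : ℝ) else (if p₁.2 - p₀.2 = 0 then (0 : ℝ) else 1) * ‖contr ℂ ((hubbardGridSub L M β (2 * (2 * M))).transpose * hubbardCovAboveCT L M β μ 0 0 klE0 *
                hubbardGridSub L M β (2 * (2 * M))) (((p₁, σ), 0) : GridLeg (GridPoint L (2 * (2 * M)))) ((p₀, σ), 1) *
              (contr ℂ ((hubbardGridSub L M β (2 * (2 * M))).transpose * hubbardCovAboveCT L M β μ 0 0 klE0 *
                hubbardGridSub L M β (2 * (2 * M))) (((p₀, σ.rev), 0) : GridLeg (GridPoint L (2 * (2 * M)))) ((p₁, σ.rev), 1) *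
                contr ℂ ((hubbardGridSub L M β (2 * (2 * M))).transpose * hubbardCovAboveCT L M β μ 0 0 klE0 *
                hubbardGridSub L M β (2 * (2 * M))) (((p₁, σ.rev), 0) : GridLeg (GridPoint L (2 * (2 * M)))) ((p₀, σ.rev), 1))‖) ≤ b.bSℝ 0 * (((2 * (2 * M) : ℕ) : ℝ) / β)) ∧
    (∀ k, 1 ≤ k → k ≤ 2 → ∀ (σ : Fin 2) (p₀ : GridPoint L (2 * (2 * M))), ∑ p₁ : GridPoint L (2 * (2 * M)),
      (if p₁ = p₀ then (0 : ℝ) else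
        Real.sqrt ((((p₁.2 - p₀.2) 0).valMinAbs.natAbs : ℝ) ^ 2 + (((p₁.2 - p₀.2) 1).valMinAbs.natAbs : ℝ) ^ 2) ^ k * ‖contr ℂ ((hubbardGridSub L M β (2 * (2 * M))).transpose * hubbardCovAboveCT L M β μ 0 0 klE0 *
                hubbardGridSub L M β (2 * (2 * M))) (((p₁, σ), 0) : GridLeg (GridPoint L (2 * (2 * M)))) ((p₀, σ), 1) *
              (contr ℂ ((hubbardGridSub L M β (2 * (2 * M))).transpose * hubbardCovAboveCT L M β μ 0 0 klE0 *
                hubbardGridSub L M β (2 * (2 * M))) (((p₀, σ.rev), 0) : GridLeg (GridPoint L (2 * (2 * M)))) ((p₁, σ.rev), 1) *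
                contr ℂ ((hubbardGridSub L M β (2 * (2 * M))).transpose * hubbardCovAboveCT L M β μ 0 0 klE0 *
                hubbardGridSub L M β (2 * (2 * M))) (((p₁, σ.rev), 0) : GridLeg (GridPoint L (2 * (2 * M)))) ((p₀, σ.rev), 1))‖) ≤
        b.bSℝ k * (((2 * (2 * M) : ℕ) : ℝ) / β)) := by
  refine sunsetRows_window_of_bundles (L := L) (M := M) l rs ?_ hc hr hrs hside hμ hβ hU0 hU hL3 hM3
  intro ν hν
  obtain ⟨hν1, hν2⟩ := (mem_klWindowC_iff_rat ν).1 hν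
  obtain ⟨c, hc', h1, h2⟩ := exists_mem_cell_of_chain _ _ _ hne hhead hlast hchain ν hν1 hν2
  obtain ⟨b, hb, rfl⟩ := List.mem_map.1 hc'
  exact ⟨b, hb, h1, h2⟩

end Window

end Summit.HubbardSuperconductivity.HubbardSuperconductivity.Theorems.KLRegimeSplit

end
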